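import Literature.Probability.RandomPlanarGeometry.SLEHullBoundaryAreaLargeKappa
import Literature.Probability.RandomPlanarGeometry.SLETransienceProofs
import HarnessLib

/-!
# Transience of the SLE trace (Rohde–Schramm (2005), Thm. 7.1) from the two trace-existence inputs

Trunk T-STOCH; theorems only. The named fact
`Literature.Probability.RandomPlanarGeometry.tendsto_norm_sleTrace_atTop` — S. Rohde, O. Schramm,
*Basic properties of SLE*, Ann. of Math. 161 (2005), Thm. 7.1 with the Update (p. 911): for every
`κ > 0`, almost surely `|γ(t)| → ∞` — now follows from exactly the two inputs through which the
trace exists: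

* Rohde–Schramm's derivative estimate Cor. 3.5 (`RohdeSchramm2005_cor35`, whence Thm. 5.1: SLE_κ
  is generated by a curve for `κ ≠ 8`, `hasSLETrace_of_ne_eight_of_cor35`), and
* Lawler–Schramm–Werner's Thm. 4.7 (`hasSLETrace_eight`: SLE₈ is generated by a curve).

Everything in §7 between these inputs and Thm. 7.1 is proved in the tree: the zero–one reduction
and scaling (`SLETransienceZeroOne`, `SLETransience`), Lemma 7.2 for `κ < 4` (Koebe route,
`SLETransienceKappaLtFour`, `SLETransienceLocal`) and at `κ = 4` (`SLEKappaFourAvoidance`), the two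
accesses at the base of a simple slit and the simple-path step (`LoewnerSlitAccesses`,
`SLETransienceProofs`: `RohdeSchramm2005_thm71_simpleStep_holds`), Lemma 7.3 for `4 < κ < 8`
(`SLETransienceKappaFourEight`, `SLETransienceLemma73`), and the `κ ≥ 8` branch through the null
area of the hull frontier (`SLETransienceKappaEight`, `SLEHullBoundaryArea`,
`SLEHullBoundaryAreaLargeKappa`).

## References

* S. Rohde, O. Schramm, *Basic properties of SLE*, Ann. of Math. 161 (2005), Thm. 7.1, Lemmas 7.2,
  7.3, Cor. 3.5, Thm. 5.1, Update (p. 911).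
* G. F. Lawler, O. Schramm, W. Werner, *Conformal invariance of planar loop-erased random walks and
  uniform spanning trees*, Ann. Probab. 32 (2004), Thm. 4.7.
-/

noncomputable section

open scoped NNReal

namespace Literature.Probability.RandomPlanarGeometry

/-- **Rohde–Schramm (2005), Thm. 7.1 with the Update, from Cor. 3.5 and [LSW] Thm. 4.7 alone**:
`tendsto_norm_sleTrace_atTop_of_cor35_of_simpleStep_of_eight` with the simple-path step discharged
(`RohdeSchramm2005_thm71_simpleStep_holds`). [cite: RohdeSchramm2005, Thm 7.1 and Update (p. 911)] -/
theorem tendsto_norm_sleTrace_atTop_of_cor35_of_eight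
    (h35 : RohdeSchramm2005_cor35 Process.preWienerMeasure) (h8e : hasSLETrace_eight) :
    tendsto_norm_sleTrace_atTop :=
  tendsto_norm_sleTrace_atTop_of_cor35_of_simpleStep_of_eight h35 RohdeSchramm2005_thm71_simpleStep_holds h8e

/-- In particular, for `κ ≠ 8` transience needs Cor. 3.5 only: **for every `κ > 0`, `κ ≠ 8`,
a.s. `|γ(t)| → ∞`, from `RohdeSchramm2005_cor35`.** [cite: RohdeSchramm2005, Thm 7.1] -/
theorem tendsto_norm_sleTrace_atTop_of_cor35_of_ne_eight
    (h35 : RohdeSchramm2005_cor35 Process.preWienerMeasure) {κ : ℝ≥0} (hκ0 : 0 < κ) (hκ8 : κ ≠ 8) :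
    ∀ᵐ ω ∂Process.preWienerMeasure, Filter.Tendsto (fun t ↦ ‖sleTrace κ ω t‖) Filter.atTop Filter.atTop := by
  rcases lt_trichotomy κ 8 with hlt | rfl | hgt
  · rcases eq_or_ne κ 4 with rfl | hκ4
    · exact tendsto_norm_sleTrace_atTop_of_notMem_closure (hasSLETrace_of_ne_eight_of_cor35 h35 hκ8)
        (fun hc ↦ identDistrib_sleTrace_scale_of_hasSLETrace (hasSLETrace_of_ne_eight_of_cor35 h35 hκ8) hc)
        (RohdeSchramm2005_thm71_simpleStep_holds le_rfl (hasSLETrace_of_ne_eight_of_cor35 h35 hκ8))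
    · exact tendsto_norm_sleTrace_atTop_of_cor35_of_lt_eight h35 hκ0 hκ4 hlt
  · exact absurd rfl hκ8
  · have h0 : HasSLETrace κ := hasSLETrace_of_ne_eight_of_cor35 h35 hκ8
    exact tendsto_norm_sleTrace_atTop_of_frontier_null h0 hgt.le
      (fun t ↦ ae_volume_frontier_sleHull_eq_zero_of_cor35 h35 hgt.le h0 t)

end Literature.Probability.RandomPlanarGeometry
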